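import Summits.QuantumFields.BalabanUV.T4Continuum.Support.SkeletonFill
import Summits.QuantumFields.BalabanUV.T4Continuum.Support.AveragingDeficitLiftPeriodic

/-!
# T⁴ programme, node NE3 — the kinematic refinement lemma, leaf R1a+R1b (row NE3-S4c), file 3:
# THE 2-SKELETON FILLING FOR UNITARY MATRICES — unitary `L²`-th roots, plaquettes within `4a/L²` of `1`, fluxes
# `= L^{−2}·log T(∂p)`, covariant flux gradients ZERO inside the 2-cells and `= L^{−2} ×` the coarse ones across lines

Cell `pub-balaban`, NE3 (node U1b) formalisation swarm, unit `b2b-balaban-t4-ne3-formalise-leaf-01` (LEAF PROVER 01),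
row **S4c** of `t4/formal/NE3/LEAVES.md` (leaf R1a+R1b of the OWNER skeleton `t4/b2b-balaban-t4-ne3-p1/SKELETON-NE3-P1.md`
v1.1 §3).  Files 1–2 (`SkeletonLattice`, `SkeletonFill`) built the 2-skeleton filling of a refined lattice in closed form
for any group and proved the two exact identities (every fine plaquette of a coarse 2-cell EQUALS the root `h`; every
chain product EQUALS the datum `T`).  THIS FILE specialises to `U(N) ⊂ M_N(ℂ)` (operator norm (19) of B7 =
[Balaban1985Averaging]) with the canonical unitary root and reads off the REGULARITY OF THE FILLING ON THE 2-SKELETON: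

* §1 the root: `rootLog L T z κ ν = L^{−2} • mlog T(∂p_{κν}(z))`, `rootH = expUnit rootLog`; `rootH_pow`
  (`h^{L·L} = T(∂p)` when `‖T(∂p) − 1‖ < 1`: `exp_nsmul` + the tree's `MatrixLog.exp_mlog`), `rootH_mem_unitary`
  (`T` unitary, `‖T(∂p) − 1‖ ≤ 1/4`: the tree's `star_mlog_eq_neg` + Mathlib's `exp_mem_unitary_of_mem_skewAdjoint`),
  `norm_rootH_sub_one_le` (`‖h − 1‖ ≤ 4a/L²` for `‖T(∂p) − 1‖ ≤ a ≤ 1/4`), `Ad_rootH_pow_rootLog` (`h` commutes with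
  its logarithm);
* §2 the configuration `fill2 L T := skelFill L T (rootH L T)` under the hypothesis SHAPE `SkeletonDatum L P a T`
  (`1 ≤ L`; `T` unitary, `P`-periodic, `SmallField T a`, `a ≤ 1/4`): `isUnitaryCfg_fill2`, `isPeriodicCfg_fill2` (period
  `L·P`), `hol_seg_fill2` ∕ **`bavg_fill2`** (`bavg L (fill2 L T) (L•z) κ = expUnit (Xavg …) * T z κ` — (42) with the
  chain product evaluated), **`fhol_fill2`** (every fine plaquette of the coarse 2-cell `(z; κ<ν)` IS `rootH L T z κ ν`),
  `norm_fhol_fill2_sub_one_le` (`≤ 4a/L²`), **`flux_fill2`** (`= L^{−2} • mlog T(∂p)`, the tree's `B7BlockAvgLog.mlog_exp`),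
  **`covGrad_fill2_inCell_left∕right = 0`** (the connecting bonds `h^{−t}` ∕ `1` commute with `log h`),
  **`covGrad_fill2_cross_left∕right`** (across a coarse line the covariant flux gradient of the filling is EXACTLY
  `Ad_{h^{−t}}` ∕ `Ad_{h^{sL}}` of `L^{−2} • covGrad T (flux T) z μ π` — the coarse covariant flux gradient of the datum),
  and their norms `= L^{−2} · ‖covGrad T (flux T) z μ π‖`.
So, ON THE 2-SKELETON, the third-order smallness required by `SmoothRefine` (fine plaquettes `O(a/L²)`, fine flux
gradients `O((coarse gradient + a²)/L²)`) is LITERALLY the regularity of the datum `T`; the plaquettes interior to the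
coarse cells of dimension `≥ 3` (row S4d), the loop-log prediction and mismatch (row S4e), the transfer from `U` to the
pre-compensated `T = exp(−X₀)·U` (file 4 `SkeletonPrecomp`: small-field transport; the flux-GRADIENT transport is open)
and the glue R0 are NOT here.

HONEST FRAMING.  Elementary lattice gauge kinematics; no estimate of the series, no minimiser, no variational problem;
no conditional of the cell (`BetaPertH`, (B), (B^μ)) is used or hidden; nothing bears on infinite volume, a mass gap, or
the Clay problem; **NE3 is NOT proved** — this is part of one leaf of the kinematic lemma `SmoothRefine` (ours,
unproved), itself a hypothesis of `MinimalActionRefine.sandwichData_of_smoothRefine`; it instantiates NO leaf of NE3 on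
Bałaban's minimisers.  Finite T⁴ rung (B)+1.  ABSOLUTE RULE of the cell kept: no printed sentence is a hypothesis of any
declaration (`SkeletonDatum` is a hypothesis SHAPE on data); no `sorry`, axioms ⊆ {propext, Classical.choice, Quot.sound}.
PLACEMENT (human rule 2026-08-19): cell work under `Summits/QuantumFields/BalabanUV/`; imports file 2 and the accepted
`Support.AveragingDeficitLiftPeriodic` (for `hol_shift`, `Ad` lemmas, `unitaryUnits` transport); moves nothing.  Records:
`t4/formal/NE3/LEAVES.md` row S4c, skeleton v1.1 of the cell `pub-balaban`.
-/

set_option autoImplicit false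

open scoped BigOperators Matrix Matrix.Norms.L2Operator
open NormedSpace Finset

namespace Summit.QuantumFields.BalabanUV.T4Continuum.SkeletonFillUnitary

open Literature.MathematicalPhysics.QuantumFieldTheory.Balaban1983to89
open B7Prop1Explicit B7Prop2Explicit B7Prop1Local MatrixLog
open T4AveragingDeficitWall hiding Site Plane Plaq Bond
open T4AveragingDeficitWallBoundary (IsPeriodicCfg)
open AveragingDeficitTransport (norm_Ad_of_unitary)
open AveragingDeficitNearIdentity (Ad_one Ad_real_smul)
open T4AveragingDeficitNonAbelian (Ad_mul Ad_sub)
open AveragingDeficitLiftPeriodic (hol_shift)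
open SkeletonLattice SkeletonFill

noncomputable section

variable {d : ℕ} {n : Type*} [Fintype n] [DecidableEq n]

/-! ## §1 The unitary `L²`-th root of the cell holonomy -/

/-- The scalar `L^{−2}`. [folklore] -/
def rootCoeff (L : ℕ) : ℝ := (((L : ℝ) ^ 2))⁻¹

/-- THE ROOT EXPONENT `Y(z; κ, ν) = L^{−2} · log T(∂p_{κν}(z))` (principal logarithm `mlog` of the plaquette holonomy of
the 1-skeleton datum `T` read as a configuration on the coarse lattice). [folklore] -/
def rootLog (L : ℕ) (T : B7Prop1Explicit.Site d → Fin d → (Matrix n n ℂ)ˣ) (z : B7Prop1Explicit.Site d) (κ ν : Fin d) :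
    Matrix n n ℂ :=
  rootCoeff L • mlog ((hol T z (plaqWord κ ν) : (Matrix n n ℂ)ˣ) : Matrix n n ℂ)

/-- THE ROOT DATUM `h(z; κ, ν) = exp(L^{−2} · log T(∂p_{κν}(z)))` — the `L²`-th root of the cell holonomy. [folklore] -/
def rootH (L : ℕ) (T : B7Prop1Explicit.Site d → Fin d → (Matrix n n ℂ)ˣ) (z : B7Prop1Explicit.Site d) (κ ν : Fin d) :
    (Matrix n n ℂ)ˣ :=
  expUnit (rootLog L T z κ ν)

omit [Fintype n] [DecidableEq n] in
/-- `(L·L) • L^{−2} • Y = Y`. [folklore] -/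
theorem nsmul_rootCoeff_smul {L : ℕ} (hL : 1 ≤ L) (Y : Matrix n n ℂ) : (L * L) • (rootCoeff L • Y) = Y := by
  rw [← Nat.cast_smul_eq_nsmul ℝ, smul_smul, rootCoeff]
  have hL' : (L : ℝ) ≠ 0 := by exact_mod_cast (by omega : L ≠ 0)
  rw [show ((L * L : ℕ) : ℝ) * ((L : ℝ) ^ 2)⁻¹ = 1 by push_cast; field_simp, one_smul]

/-- **`h^{L²} = T(∂p)`** whenever `‖T(∂p) − 1‖ < 1` (the principal logarithm inverts `exp` there). [folklore] -/
theorem rootH_pow {L : ℕ} (hL : 1 ≤ L) (T : B7Prop1Explicit.Site d → Fin d → (Matrix n n ℂ)ˣ)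
    (z : B7Prop1Explicit.Site d) (κ ν : Fin d)
    (hT : ‖((hol T z (plaqWord κ ν) : (Matrix n n ℂ)ˣ) : Matrix n n ℂ) - 1‖ < 1) :
    (rootH L T z κ ν) ^ (L * L) = hol T z (plaqWord κ ν) := by
  letI : NormedAlgebra ℚ (Matrix n n ℂ) := NormedAlgebra.restrictScalars ℚ ℝ (Matrix n n ℂ)
  ext1
  rw [Units.val_pow_eq_pow_val, rootH, val_expUnit, ← exp_nsmul, rootLog, nsmul_rootCoeff_smul hL, exp_mlog hT]

/-- `0 ≤ L^{−2} ≤ 1` for `1 ≤ L`. [folklore] -/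
theorem rootCoeff_nonneg (L : ℕ) : 0 ≤ rootCoeff L := by unfold rootCoeff; positivity

/-- `L^{−2} ≤ 1` for `1 ≤ L`. [folklore] -/
theorem rootCoeff_le_one {L : ℕ} (hL : 1 ≤ L) : rootCoeff L ≤ 1 := by
  unfold rootCoeff
  have : (1 : ℝ) ≤ (L : ℝ) ^ 2 := one_le_pow₀ (by exact_mod_cast hL)
  exact inv_le_one_of_one_le₀ this

/-- **Size of the root exponent**: `‖Y‖ ≤ L^{−2} · 2‖T(∂p) − 1‖` when `‖T(∂p) − 1‖ ≤ 1/2` (B7 (26)). [folklore] -/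
theorem norm_rootLog_le {L : ℕ} (T : B7Prop1Explicit.Site d → Fin d → (Matrix n n ℂ)ˣ)
    (z : B7Prop1Explicit.Site d) (κ ν : Fin d) {a : ℝ}
    (hT : ‖((hol T z (plaqWord κ ν) : (Matrix n n ℂ)ˣ) : Matrix n n ℂ) - 1‖ ≤ a) (ha : a ≤ 1 / 2) :
    ‖rootLog L T z κ ν‖ ≤ rootCoeff L * (2 * a) := by
  rw [rootLog, norm_smul, Real.norm_of_nonneg (rootCoeff_nonneg L)]
  refine mul_le_mul_of_nonneg_left ?_ (rootCoeff_nonneg L)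
  exact (norm_mlog_le_two_mul (hT.trans ha)).trans (by linarith)

/-- **Size of the root**: `‖h − 1‖ ≤ 4a/L²` when `‖T(∂p) − 1‖ ≤ a ≤ 1/4`. [folklore] -/
theorem norm_rootH_sub_one_le {L : ℕ} (hL : 1 ≤ L) (T : B7Prop1Explicit.Site d → Fin d → (Matrix n n ℂ)ˣ)
    (z : B7Prop1Explicit.Site d) (κ ν : Fin d) {a : ℝ}
    (hT : ‖((hol T z (plaqWord κ ν) : (Matrix n n ℂ)ˣ) : Matrix n n ℂ) - 1‖ ≤ a) (ha : a ≤ 1 / 4) :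
    ‖((rootH L T z κ ν : (Matrix n n ℂ)ˣ) : Matrix n n ℂ) - 1‖ ≤ rootCoeff L * (4 * a) := by
  have ha0 : 0 ≤ a := (norm_nonneg _).trans hT
  have hY := norm_rootLog_le (L := L) T z κ ν hT (by linarith)
  have hc1 := rootCoeff_le_one hL
  have hc0 := rootCoeff_nonneg L
  have hx1 : rootCoeff L * (2 * a) ≤ 1 := by nlinarith
  rw [rootH, val_expUnit]
  have hx0 : 0 ≤ rootCoeff L * (2 * a) := mul_nonneg hc0 (by linarith)
  calc ‖exp (rootLog L T z κ ν) - 1‖ ≤ Real.exp (rootCoeff L * (2 * a)) - 1 := (norm_exp_sub_one_le_of_norm_le hY).1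
    _ ≤ 2 * (rootCoeff L * (2 * a)) := by
        have h := Real.abs_exp_sub_one_le (x := rootCoeff L * (2 * a)) (by rw [abs_of_nonneg hx0]; exact hx1)
        rw [abs_of_nonneg hx0] at h
        exact (le_abs_self _).trans h
    _ = rootCoeff L * (4 * a) := by ring

/-- **The root is unitary** when `T` is unitary-valued and `‖T(∂p) − 1‖ ≤ 1/4` (its exponent is skew-adjoint: B7
(22)–(23), tree `star_mlog_eq_neg`). [folklore] -/
theorem rootH_mem_unitary {L : ℕ} {T : B7Prop1Explicit.Site d → Fin d → (Matrix n n ℂ)ˣ} (hT : IsUnitaryCfg T)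
    (z : B7Prop1Explicit.Site d) (κ ν : Fin d)
    (hsmall : ‖((hol T z (plaqWord κ ν) : (Matrix n n ℂ)ˣ) : Matrix n n ℂ) - 1‖ ≤ 1 / 4) :
    rootH L T z κ ν ∈ unitaryUnits (Matrix n n ℂ) := by
  letI : CStarAlgebra (Matrix n n ℂ) := {}
  letI : NormedAlgebra ℚ (Matrix n n ℂ) := NormedAlgebra.restrictScalars ℚ ℝ (Matrix n n ℂ)
  rw [mem_unitaryUnits, rootH, val_expUnit]
  refine NormedSpace.exp_mem_unitary_of_mem_skewAdjoint ?_
  unfold rootLog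
  refine skewAdjoint.smul_mem _ ?_
  rw [skewAdjoint.mem_iff]
  exact star_mlog_eq_neg (mem_unitaryUnits.mp (hol_mem_of hT _ _)) hsmall

/-- The root exponent commutes with the root: `Y · h = h · Y`. [folklore] -/
theorem rootLog_commute_rootH (L : ℕ) (T : B7Prop1Explicit.Site d → Fin d → (Matrix n n ℂ)ˣ)
    (z : B7Prop1Explicit.Site d) (κ ν : Fin d) :
    Commute (rootLog L T z κ ν) ((rootH L T z κ ν : (Matrix n n ℂ)ˣ) : Matrix n n ℂ) := by
  rw [rootH, val_expUnit]
  exact (Commute.refl _).exp_right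

/-- Hence `Ad_{h^m} Y = Y` and `Ad_{(h^m)⁻¹} Y = Y`. [folklore] -/
theorem Ad_rootH_pow_rootLog (L : ℕ) (T : B7Prop1Explicit.Site d → Fin d → (Matrix n n ℂ)ˣ)
    (z : B7Prop1Explicit.Site d) (κ ν : Fin d) (m : ℕ) :
    Ad ((rootH L T z κ ν) ^ m) (rootLog L T z κ ν) = rootLog L T z κ ν ∧
      Ad ((rootH L T z κ ν) ^ m)⁻¹ (rootLog L T z κ ν) = rootLog L T z κ ν := by
  have hc : Commute (rootLog L T z κ ν) (((rootH L T z κ ν) ^ m : (Matrix n n ℂ)ˣ) : Matrix n n ℂ) := by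
    rw [Units.val_pow_eq_pow_val]; exact (rootLog_commute_rootH L T z κ ν).pow_right m
  constructor
  · unfold Ad; rw [← hc.eq, mul_assoc, Units.mul_inv, mul_one]
  · unfold Ad
    rw [inv_inv]
    have hc' : Commute (rootLog L T z κ ν) (((rootH L T z κ ν ^ m)⁻¹ : (Matrix n n ℂ)ˣ) : Matrix n n ℂ) :=
      hc.units_inv_right
    rw [← hc'.eq, mul_assoc, Units.inv_mul, mul_one]

/-! ## §2 The 2-skeleton filling of a unitary 1-skeleton datum: the configuration `fill2 L T` -/

/-- THE 2-SKELETON FILLING OF THE UNITARY 1-SKELETON DATUM `T`: `skelFill L T (rootH L T)` — the closed form of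
file 2 with the unitary `L²`-th roots of §1 (value `1` inside the coarse cells of dimension `≥ 3`, row S4d's to fill).
[folklore] -/
def fill2 (L : ℕ) (T : B7Prop1Explicit.Site d → Fin d → (Matrix n n ℂ)ˣ) :
    B7Prop1Explicit.Site d → Fin d → (Matrix n n ℂ)ˣ :=
  skelFill L T (rootH L T)

/-- THE HYPOTHESIS PACKAGE ON THE 1-SKELETON DATUM (a parametric SHAPE on data, not a fact): block size `L ≥ 1`; `T`
unitary-valued and `P`-periodic on the coarse lattice; every plaquette holonomy `T(∂p)` within `a ≤ 1/4` of `1` (the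
tree's `SmallField T a`). [shape] [folklore] -/
@[folklore]
structure SkeletonDatum (L : ℕ) (P : ℤ) (a : ℝ) (T : B7Prop1Explicit.Site d → Fin d → (Matrix n n ℂ)ˣ) : Prop where
  /-- `1 ≤ L` -/
  one_le : 1 ≤ L
  /-- `U(N)`-valued -/
  unitary : IsUnitaryCfg T
  /-- `P`-periodic on the coarse lattice -/
  periodic : IsPeriodicCfg T P
  /-- plaquette holonomies within `a` of `1` -/
  small : SmallField T a
  /-- `a ≤ 1/4` -/
  le_quarter : a ≤ 1 / 4

section Consequences

variable {L : ℕ} {P : ℤ} {a : ℝ} {T : B7Prop1Explicit.Site d → Fin d → (Matrix n n ℂ)ˣ}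

/-- Under the datum hypotheses every plaquette holonomy of `T` (any two directions) is within `1/4` of `1`. [folklore] -/
theorem SkeletonDatum.small_all (hD : SkeletonDatum L P a T) (z : B7Prop1Explicit.Site d) (κ ν : Fin d) :
    ‖((hol T z (plaqWord κ ν) : (Matrix n n ℂ)ˣ) : Matrix n n ℂ) - 1‖ ≤ 1 / 4 := by
  by_cases hκν : κ = ν
  · subst hκν
    rw [hol_plaqWord_self, Units.val_one, sub_self, norm_zero]
    norm_num
  · exact (hD.small z κ ν hκν).trans hD.le_quarter

/-- `0 ≤ a` under the datum hypotheses (when `d ≥ 2`; in general from any plaquette). [folklore] -/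
theorem SkeletonDatum.nonneg (hD : SkeletonDatum L P a T) {κ ν : Fin d} (hκν : κ ≠ ν) : 0 ≤ a :=
  (norm_nonneg _).trans (hD.small 0 κ ν hκν)

/-- `fill2` is lawful on the 2-skeleton (file 2). [folklore] -/
theorem lawfulFill_fill2 (L : ℕ) (T : B7Prop1Explicit.Site d → Fin d → (Matrix n n ℂ)ˣ) :
    LawfulFill L T (rootH L T) (fill2 L T) :=
  lawfulFill_skelFill T (rootH L T)

/-- **UNITARITY** of the 2-skeleton filling. [folklore] -/
theorem isUnitaryCfg_fill2 (hD : SkeletonDatum L P a T) : IsUnitaryCfg (fill2 L T) := fun x μ =>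
  skelFill_mem hD.unitary (fun z κ ν => rootH_mem_unitary hD.unitary z κ ν (hD.small_all z κ ν)) x μ

/-- The roots of a `P`-periodic datum are `P`-periodic. [folklore] -/
theorem rootH_add_period (hP : IsPeriodicCfg T P) (L : ℕ) (z : B7Prop1Explicit.Site d) (κ μ ν : Fin d) :
    rootH L T (z + P • e κ) μ ν = rootH L T z μ ν := by
  unfold rootH rootLog
  rw [hol_shift (W := T) (W' := T) (t := P • e κ) (fun x i => hP x κ i) (plaqWord μ ν) z]

/-- **PERIODICITY**: the 2-skeleton filling of a `P`-periodic datum is `L·P`-periodic (a configuration on the refined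
torus). [folklore] -/
theorem isPeriodicCfg_fill2 (hD : SkeletonDatum L P a T) : IsPeriodicCfg (fill2 L T) ((L : ℤ) * P) :=
  fun x κ μ => skelFill_add_period hD.one_le (fun z κ' μ' => hD.periodic z κ' μ') (rootH_add_period hD.periodic L) x κ μ

/-- **CHAIN PRODUCTS**: `fill2(Γ_c) = T(c)` for every coarse bond `c = (z, κ)`; hence the averaged bond of (42) is
`\overline{fill2}(c) = exp(X_c(fill2)) · T(z, κ)`. [folklore] -/
theorem hol_seg_fill2 (hL : 1 ≤ L) (z : B7Prop1Explicit.Site d) (κ : Fin d) :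
    hol (fill2 L T) ((L : ℤ) • z) (seg κ L) = T z κ :=
  hol_seg_eq (lawfulFill_fill2 L T) hL z κ

/-- `bavg L (fill2 L T) (L•z) κ = expUnit (Xavg L (fill2 L T) (L•z) κ) * T z κ` ((42) with the chain product
evaluated). [folklore] -/
theorem bavg_fill2 (hL : 1 ≤ L) (z : B7Prop1Explicit.Site d) (κ : Fin d) :
    bavg L (fill2 L T) ((L : ℤ) • z) κ = expUnit (Xavg L (fill2 L T) ((L : ℤ) • z) κ) * T z κ := by
  rw [bavg, hol_seg_fill2 hL]

/-- **EVERY FINE PLAQUETTE OF THE COARSE 2-CELL `(z; κ < ν)` IS THE UNITARY ROOT `h(z; κ, ν)`**. [folklore] -/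
theorem hol_plaq_fill2 (hD : SkeletonDatum L P a T) {κ ν : Fin d} (hκν : κ < ν) (z : B7Prop1Explicit.Site d)
    {s t : ℕ} (hs : s < L) (ht : t < L) :
    hol (fill2 L T) ((L : ℤ) • z + off2 κ ν s t) (plaqWord κ ν) = rootH L T z κ ν :=
  hol_plaq_eq (lawfulFill_fill2 L T) hκν z
    (rootH_pow hD.one_le T z κ ν (by linarith [hD.small_all z κ ν])) hs ht

/-- The same in the tree's `fhol` notation for the plaquette `(x, π)`, `π = (κ < ν)`. [folklore] -/
theorem fhol_fill2 (hD : SkeletonDatum L P a T) {κ ν : Fin d} (hκν : κ < ν) (z : B7Prop1Explicit.Site d)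
    {s t : ℕ} (hs : s < L) (ht : t < L) :
    fhol (fill2 L T) ((L : ℤ) • z + off2 κ ν s t, ⟨(κ, ν), hκν⟩) = rootH L T z κ ν :=
  hol_plaq_fill2 hD hκν z hs ht

/-- **SMALL FIELD ON THE 2-SKELETON**: every fine plaquette of a coarse 2-cell is within `4a/L²` of `1`. [folklore] -/
theorem norm_fhol_fill2_sub_one_le (hD : SkeletonDatum L P a T) {κ ν : Fin d} (hκν : κ < ν)
    (z : B7Prop1Explicit.Site d) {s t : ℕ} (hs : s < L) (ht : t < L) :
    ‖((fhol (fill2 L T) ((L : ℤ) • z + off2 κ ν s t, ⟨(κ, ν), hκν⟩) : (Matrix n n ℂ)ˣ) : Matrix n n ℂ) - 1‖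
      ≤ rootCoeff L * (4 * a) := by
  rw [fhol_fill2 hD hκν z hs ht]
  exact norm_rootH_sub_one_le hD.one_le T z κ ν (hD.small z κ ν (ne_of_lt hκν)) hD.le_quarter

/-- **THE FLUX OF A 2-CELL PLAQUETTE IS `L^{−2} · log T(∂p)`** (`flux = mlog ∘ fhol`; `log exp Y = Y` for
`‖Y‖ < log 2`, tree `B7BlockAvgLog.mlog_exp`). [folklore] -/
theorem flux_fill2 (hD : SkeletonDatum L P a T) {κ ν : Fin d} (hκν : κ < ν) (z : B7Prop1Explicit.Site d)
    {s t : ℕ} (hs : s < L) (ht : t < L) :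
    flux (fill2 L T) ((L : ℤ) • z + off2 κ ν s t, ⟨(κ, ν), hκν⟩) = rootLog L T z κ ν := by
  rw [flux, fhol_fill2 hD hκν z hs ht, rootH, val_expUnit]
  refine B7BlockAvgLog.mlog_exp ?_
  have ha0 := hD.nonneg (ne_of_lt hκν)
  have hY := norm_rootLog_le (L := L) T z κ ν (hD.small z κ ν (ne_of_lt hκν)) (by linarith [hD.le_quarter])
  have hc := rootCoeff_le_one hD.one_le
  have : rootCoeff L * (2 * a) ≤ 1 / 2 := by nlinarith [hD.le_quarter, rootCoeff_nonneg L]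
  linarith [Real.log_two_gt_d9]

/-- The coarse covariant flux gradient of the datum `T` across the plaquettes `(κ < ν)` in direction `μ`, spelled out:
`Ad_{T(z,μ)} log T(∂p_{κν}(z + e_μ)) − log T(∂p_{κν}(z))`. [folklore] -/
theorem covGrad_flux_datum (T : B7Prop1Explicit.Site d → Fin d → (Matrix n n ℂ)ˣ) {κ ν : Fin d} (hκν : κ < ν)
    (z : B7Prop1Explicit.Site d) (μ : Fin d) :
    covGrad T (flux T) z μ ⟨(κ, ν), hκν⟩
      = Ad (T z μ) (mlog ((hol T (z + e μ) (plaqWord κ ν) : (Matrix n n ℂ)ˣ) : Matrix n n ℂ))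
        - mlog ((hol T z (plaqWord κ ν) : (Matrix n n ℂ)ˣ) : Matrix n n ℂ) := rfl

/-- **IN-CELL COVARIANT FLUX GRADIENTS VANISH, direction `κ`**: between the plaquettes at `(s, t)` and `(s+1, t)` of
the same cell (`s + 1 < L`) the covariant gradient of the flux of `fill2` is `0` (the connecting bond is `h^{−t}`, which
commutes with `log h`). [folklore] -/
theorem covGrad_fill2_inCell_left (hD : SkeletonDatum L P a T) {κ ν : Fin d} (hκν : κ < ν)
    (z : B7Prop1Explicit.Site d) {s t : ℕ} (hs : s + 1 < L) (ht : t < L) :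
    covGrad (fill2 L T) (flux (fill2 L T)) ((L : ℤ) • z + off2 κ ν s t) κ ⟨(κ, ν), hκν⟩ = 0 := by
  rw [covGrad, add_assoc, off2_add_e_left, flux_fill2 hD hκν z hs ht, flux_fill2 hD hκν z (by omega) ht,
    val_horizontal (lawfulFill_fill2 L T) hκν z (by omega) ht, if_neg (by omega), mul_one,
    (Ad_rootH_pow_rootLog L T z κ ν t).2, sub_self]

/-- **IN-CELL COVARIANT FLUX GRADIENTS VANISH, direction `ν`**: between the plaquettes at `(s, t)` and `(s, t+1)` of
the same cell (`t + 1 < L`) the covariant gradient of the flux of `fill2` is `0` (the connecting bond is `1`).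
[folklore] -/
theorem covGrad_fill2_inCell_right (hD : SkeletonDatum L P a T) {κ ν : Fin d} (hκν : κ < ν)
    (z : B7Prop1Explicit.Site d) {s t : ℕ} (hs : s < L) (ht : t + 1 < L) :
    covGrad (fill2 L T) (flux (fill2 L T)) ((L : ℤ) • z + off2 κ ν s t) ν ⟨(κ, ν), hκν⟩ = 0 := by
  rw [covGrad, add_assoc, off2_add_e_right, flux_fill2 hD hκν z hs ht, flux_fill2 hD hκν z hs (by omega),
    val_vertical (lawfulFill_fill2 L T) hκν z hs (by omega), if_neg (by omega), Ad_one, sub_self]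

/-- **CROSS-LINE COVARIANT FLUX GRADIENT, direction `κ`** (last column `s = L − 1` to the first column of the cell
`(z + e_κ; κ, ν)`): EXACTLY `Ad_{h^{−t}} (L^{−2} · (∇_T log T(∂p))(z, κ))` — the coarse covariant flux gradient of the
datum, scaled by `L^{−2}` and conjugated by a unitary. [folklore] -/
theorem covGrad_fill2_cross_left (hD : SkeletonDatum L P a T) {κ ν : Fin d} (hκν : κ < ν)
    (z : B7Prop1Explicit.Site d) {t : ℕ} (ht : t < L) :
    covGrad (fill2 L T) (flux (fill2 L T)) ((L : ℤ) • z + off2 κ ν (L - 1) t) κ ⟨(κ, ν), hκν⟩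
      = Ad ((rootH L T z κ ν ^ t)⁻¹) (rootCoeff L • covGrad T (flux T) z κ ⟨(κ, ν), hκν⟩) := by
  have hL := hD.one_le
  have hc := carry_left hL κ ν z t
  rw [Nat.sub_add_cancel hL] at hc
  rw [covGrad, add_assoc, off2_add_e_left, Nat.sub_add_cancel hL, hc, flux_fill2 hD hκν (z + e κ) (by omega) ht,
    flux_fill2 hD hκν z (by omega) ht,
    val_horizontal (lawfulFill_fill2 L T) hκν z (by omega) ht, if_pos rfl, Ad_mul, covGrad_flux_datum, smul_sub,
    Ad_sub, ← rootLog, ← Ad_real_smul, ← rootLog, (Ad_rootH_pow_rootLog L T z κ ν t).2]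

/-- **CROSS-LINE COVARIANT FLUX GRADIENT, direction `ν`** (top row `t = L − 1` to the bottom row of the cell
`(z + e_ν; κ, ν)`): EXACTLY `Ad_{h^{sL}} (L^{−2} · (∇_T log T(∂p))(z, ν))`. [folklore] -/
theorem covGrad_fill2_cross_right (hD : SkeletonDatum L P a T) {κ ν : Fin d} (hκν : κ < ν)
    (z : B7Prop1Explicit.Site d) {s : ℕ} (hs : s < L) :
    covGrad (fill2 L T) (flux (fill2 L T)) ((L : ℤ) • z + off2 κ ν s (L - 1)) ν ⟨(κ, ν), hκν⟩
      = Ad (rootH L T z κ ν ^ (s * L)) (rootCoeff L • covGrad T (flux T) z ν ⟨(κ, ν), hκν⟩) := by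
  have hL := hD.one_le
  have hc := carry_right hL κ ν z s
  rw [Nat.sub_add_cancel hL] at hc
  rw [covGrad, add_assoc, off2_add_e_right, Nat.sub_add_cancel hL, hc, flux_fill2 hD hκν (z + e ν) hs (by omega),
    flux_fill2 hD hκν z hs (by omega),
    val_vertical (lawfulFill_fill2 L T) hκν z hs (by omega), if_pos rfl, Ad_mul, covGrad_flux_datum, smul_sub,
    Ad_sub, ← rootLog, ← Ad_real_smul, ← rootLog, (Ad_rootH_pow_rootLog L T z κ ν (s * L)).1]

/-- **NORMS OF THE CROSS-LINE GRADIENTS**: `‖∇ flux(fill2)‖ = L^{−2} · ‖(∇_T log T(∂p))‖` across the lines in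
direction `κ` … [folklore] -/
theorem norm_covGrad_fill2_cross_left (hD : SkeletonDatum L P a T) {κ ν : Fin d} (hκν : κ < ν)
    (z : B7Prop1Explicit.Site d) {t : ℕ} (ht : t < L) :
    ‖covGrad (fill2 L T) (flux (fill2 L T)) ((L : ℤ) • z + off2 κ ν (L - 1) t) κ ⟨(κ, ν), hκν⟩‖
      = rootCoeff L * ‖covGrad T (flux T) z κ ⟨(κ, ν), hκν⟩‖ := by
  rw [covGrad_fill2_cross_left hD hκν z ht, norm_Ad_of_unitary, norm_smul, Real.norm_of_nonneg (rootCoeff_nonneg L)]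
  exact (unitaryUnits _).inv_mem ((unitaryUnits _).pow_mem
    (rootH_mem_unitary hD.unitary z κ ν (hD.small_all z κ ν)) _)

/-- … and in direction `ν`. [folklore] -/
theorem norm_covGrad_fill2_cross_right (hD : SkeletonDatum L P a T) {κ ν : Fin d} (hκν : κ < ν)
    (z : B7Prop1Explicit.Site d) {s : ℕ} (hs : s < L) :
    ‖covGrad (fill2 L T) (flux (fill2 L T)) ((L : ℤ) • z + off2 κ ν s (L - 1)) ν ⟨(κ, ν), hκν⟩‖
      = rootCoeff L * ‖covGrad T (flux T) z ν ⟨(κ, ν), hκν⟩‖ := by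
  rw [covGrad_fill2_cross_right hD hκν z hs, norm_Ad_of_unitary, norm_smul, Real.norm_of_nonneg (rootCoeff_nonneg L)]
  exact (unitaryUnits _).pow_mem (rootH_mem_unitary hD.unitary z κ ν (hD.small_all z κ ν)) _

end Consequences

end

end Summit.QuantumFields.BalabanUV.T4Continuum.SkeletonFillUnitary
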